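import Literature.AlgebraicGeometry.Resolution.BlowupStalkBlowupAlgebra
import Summits.ResolutionOfSingularities.ResolutionOfSingularities.Theorems.FrobeniusLadderFInjectiveMacaulayficationE8Char5FiModel
import HarnessLib

/-!
# Reverse dictionary: every prime over `𝔪_b` of an affine blow-up algebra of `𝒪_{X,b}` is the local ring of a point of the
# blowing up over `b` (crux `FInjectiveMacaulayfication`, T-𝒫-loc §T0)

[OURS · L1 W4.5a · res-L1-w45a-stub-3] Support file (`--supports stmt-ResolutionOfSingularities-15315 --as helper`) for the crux
`FrobeniusLadder.FInjectiveMacaulayfication`; NOT a statement of any manuscript; AI-written, weaker than expert review. Statement =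
the strategist's sketch file `L/res-L1-w45a-strat-1/PFixTowerSig.lean` r2 sha16 b235fde4a11e66a6, §T0 `stub_blowupAlgebra_prime_realised`,
VERBATIM with the `stub_` prefix dropped (CRUX-PLAN w45a v11.1 §5 amendment; ruling R11.16: 5h = §T1 over §T0).

THE THEOREM `blowupAlgebra_prime_realised` — the CONVERSE of the tree's dictionary
`Literature.AlgebraicGeometry.Resolution.IsBlowup.exists_blowupAlgebra_stalk_ringEquiv_of_eq` (BlowupStalkBlowupAlgebra.lean): for a
blowing up `π : X' → X` along `J` (`IsBlowup`), a point `b ∈ X` and generators `c₁, …, c_n` of the stalk `J_b = (c)`, EVERY prime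
`𝔔` of the affine blow-up algebra `𝒪_{X,b}[(c)/c_j]` lying over `𝔪_b` is the local ring of some point `x' ∈ X'` over `b`:
`𝒪_{X',x'} ≅ (𝒪_{X,b}[(c)/c_j])_𝔔`. Proof = the set-up of `IsBlowup.exists_chart_morphism` (BlowupStalkCharts.lean) run
backwards: the flat base change `P = X' ×_X Spec 𝒪_{X,b} → Spec 𝒪_{X,b}` is a blowing up along `(c)~`
(`IsBlowup.pullback_snd_of_flat`, `flat_fromSpecStalk`, `comap_fromSpecStalk_eq_affineBlowupIdealSheaf`), hence isomorphic over
`Spec 𝒪_{X,b}` to `affineBlowup (c) = Proj 𝒪_{X,b}[(c)t]` (`affineBlowup.isBlowup`, `IsBlowup.unique`); `𝔔` moved to the Rees chart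
ring `(𝒪_{X,b}[(c)t])_{(c_j t)}` along `reesChartEquiv` (Stacks 07Z3) is a point `𝔴` of the chart `Spec → affineBlowup (c)`
(`affineBlowup.chartι`, an open immersion); its image `x'` under `affineBlowup (c) ≅ P → X'` has the required local ring (stalk maps
of open immersions are isomorphisms; `isIso_stalkMap_pullback_fst_fromSpecStalk`: `P → X'` is a pro-open immersion;
`Spec.stalkIso`; localizations at corresponding primes of isomorphic rings, `E8Char5FiModel.nonempty_ringEquiv_localization_comap`'s
pattern) and lies over `b` (`pullback.condition`, `affineBlowup.chartι_π`, `𝔴 ∩ 𝒪_{X,b} = 𝔪_b`, `Scheme.fromSpecStalk_closedPoint`).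
The hypotheses `IsIntegral X`, `IsLocallyNoetherian X` and «`J` of finite type» of the sketch statement are not used.

References: The Stacks Project, Tags 0804, 0805, 07Z3, 01J7; Görtz–Wedhorn I, Def. 13.90 / Prop. 13.91; the rest is folklore.
-/

-- single-problem summit: the doubled namespace component is forced
set_option linter.dupNamespace false

noncomputable section

namespace Summit.ResolutionOfSingularities.ResolutionOfSingularities.Theorems.FInjectiveMacaulayfication.BlowupAlgebraPrimeRealised

open AlgebraicGeometry CategoryTheory CategoryTheory.Limits Literature.AlgebraicGeometry.Resolution TopologicalSpace IsLocalRing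
open Summit.ResolutionOfSingularities.ResolutionOfSingularities.Theorems.FInjectiveMacaulayfication

set_option maxHeartbeats 800000 in
-- the comparison with `Proj` over `Spec 𝒪_{X,b}` elaborates large terms (as in `BlowupStalkCharts.lean`)
/-- **§T0 — REVERSE DICTIONARY** (`PFixTowerSig` r2 b235fde4a11e66a6 `stub_blowupAlgebra_prime_realised`, verbatim): every prime of
the blow-up algebra chart `𝒪_{X,b}[(c)/c_j]` lying over `𝔪_b` is the local ring of a point of the blowing up `X'` over `b`.
[cite: StacksProject, Tag 0804] -/
theorem blowupAlgebra_prime_realised : ∀ (X X' : Scheme.{0}) [IsIntegral X] [IsLocallyNoetherian X] (π : X' ⟶ X)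
    (J : X.IdealSheafData), (∀ U : X.affineOpens, (J.ideal U).FG) → IsBlowup π J →
    ∀ (b : X) (n : ℕ) (c : Fin n → X.presheaf.stalk b), Literature.AlgebraicGeometry.Resolution.stalkIdeal J b = Ideal.span (Set.range c) →
    ∀ (j : Fin n) (𝔔 : PrimeSpectrum (Literature.AlgebraicGeometry.Resolution.blowupAlgebra (Ideal.span (Set.range c)) (c j))),
      𝔔.asIdeal.comap (algebraMap (X.presheaf.stalk b) (Literature.AlgebraicGeometry.Resolution.blowupAlgebra (Ideal.span (Set.range c)) (c j))) = IsLocalRing.maximalIdeal (X.presheaf.stalk b) →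
      ∃ x' : X', π.base x' = b ∧ Nonempty (X'.presheaf.stalk x' ≃+* Localization.AtPrime 𝔔.asIdeal) := by
  intro X X' _ _ π J _ hπ b n c hc j 𝔔 h𝔔
  classical
  have hcj : ∀ j, c j ∈ Ideal.span (Set.range c) := fun j => Ideal.mem_span_range_self (f := c) (x := j)
  haveI : Flat (X.fromSpecStalk b) := flat_fromSpecStalk X b
  -- the base change `P = X' ×_X Spec 𝒪_{X,b} → Spec 𝒪_{X,b}` is a blowing up along `(c)~`
  have hP : IsBlowup (pullback.snd π (X.fromSpecStalk b)) (affineBlowup.idealSheaf (Ideal.span (Set.range c))) := by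
    have h := hπ.pullback_snd_of_flat (X.fromSpecStalk b)
    rwa [comap_fromSpecStalk_eq_affineBlowupIdealSheaf, hc] at h
  -- hence isomorphic to `Proj 𝒪_{X,b}[(c)t]` over `Spec 𝒪_{X,b}`
  obtain ⟨e, he, -⟩ := (affineBlowup.isBlowup (Ideal.span (Set.range c))).unique hP
  -- the prime `𝔔` read on the Rees chart ring `(𝒪_{X,b}[(c)t])_{(c_j t)}` along `reesChartEquiv`
  set ε : chartRing c j ≃+* blowupAlgebra (Ideal.span (Set.range c)) (c j) :=
    reesChartEquiv (I := Ideal.span (Set.range c)) (c j) (hcj j) with hεdef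
  have hε : ∀ a, ε (chartBase c j a) = algebraMap _ (blowupAlgebra (Ideal.span (Set.range c)) (c j)) a :=
    reesChartEquiv_reesChartBase (c j) _
  let w : Spec (.of (chartRing c j)) := ⟨𝔔.asIdeal.comap ε.toRingHom, Ideal.comap_isPrime _ _⟩
  -- `𝔴 = ε⁻¹ 𝔔` lies over `𝔪_b`
  have hw : w.asIdeal.comap (chartBase c j) = maximalIdeal (X.presheaf.stalk b) := by
    rw [← h𝔔]
    ext a
    simp only [Ideal.mem_comap, w]
    rw [RingEquiv.toRingHom_eq_coe, RingEquiv.coe_toRingHom, hε]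
  -- the chart through `𝔴`, the comparison `e`, and the projection to `X'`
  let q : Spec (.of (chartRing c j)) ⟶ X' :=
    (affineBlowup.chartι (c j) (hcj j) ≫ e.hom) ≫ pullback.fst π (X.fromSpecStalk b)
  have hq : q ≫ π = Spec.map (CommRingCat.ofHom (chartBase c j)) ≫ X.fromSpecStalk b := by
    simp only [q]
    rw [Category.assoc, pullback.condition, Category.assoc, reassoc_of% he, ← Category.assoc,
      affineBlowup.chartι_π (c j) (hcj j)]
  refine ⟨q w, ?_, ?_⟩
  · -- `π (q 𝔴) = b`: `q ≫ π` is `Spec (chartBase) ≫ fromSpecStalk`, `𝔴 ↦ 𝔪_b ↦ b`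
    have h1 : π.base (q w) = (Spec.map (CommRingCat.ofHom (chartBase c j)) ≫ X.fromSpecStalk b) w := by
      rw [← hq]; rfl
    rw [h1, Scheme.Hom.comp_apply, Spec.map_apply]
    have h2 : PrimeSpectrum.comap (CommRingCat.ofHom (chartBase c j)).hom w = closedPoint (X.presheaf.stalk b) := by
      apply PrimeSpectrum.ext
      rw [PrimeSpectrum.comap_asIdeal, CommRingCat.hom_ofHom, hw]
      rfl
    rw [h2]
    exact Scheme.fromSpecStalk_closedPoint
  · -- the local ring: `𝒪_{X', q 𝔴} ≅ 𝒪_{Spec B, 𝔴} ≅ B_𝔴 ≅ (𝒪_b[(c)/c_j])_𝔔`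
    have h1 := isIso_stalkMap_pullback_fst_fromSpecStalk π b ((affineBlowup.chartι (c j) (hcj j) ≫ e.hom) w)
    haveI : IsOpenImmersion (affineBlowup.chartι (c j) (hcj j) ≫ e.hom) := inferInstance
    have h2 : IsIso ((affineBlowup.chartι (c j) (hcj j) ≫ e.hom).stalkMap w) := inferInstance
    have h3 : IsIso (q.stalkMap w) := by
      simp only [q]
      rw [Scheme.Hom.stalkMap_comp]
      exact @IsIso.comp_isIso _ _ _ _ _ _ _ h1 h2
    obtain ⟨eloc⟩ := E8Char5FiModel.nonempty_ringEquiv_localization_comap (A := blowupAlgebra (Ideal.span (Set.range c)) (c j))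
      (B := chartRing c j) ε 𝔔.asIdeal
    exact ⟨((asIso (q.stalkMap w)).commRingCatIsoToRingEquiv.trans
      (Spec.stalkIso (.of (chartRing c j)) w).commRingCatIsoToRingEquiv).trans eloc⟩

end Summit.ResolutionOfSingularities.ResolutionOfSingularities.Theorems.FInjectiveMacaulayfication.BlowupAlgebraPrimeRealised

end
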